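import Summits.ValiantsHypothesis.ValiantsHypothesis.Theorems.SymmetroidPencilBasics
import Summits.ValiantsHypothesis.ValiantsHypothesis.Theorems.LacunarySymmetroidMatrixDescartesCensusDefs

/-!
# `MatrixDescartes` census — DOOR A at `(3,4)`: the NODE (Cayley-symmetroid) form of a net spanned by four rank-one letters

HONEST FRAMING.  Object-search cell `pub-symmetroid`, door-A seat `val-sym-door-p3`; item stmt-ValiantsHypothesis-19980
`DoorA34 = PosRootLawAt 3 4 18` («every real symmetric `3 × 3` four-term lacunary pencil has at most `18 = D(3,4) − 1` distinct
positive roots of its determinant») is OPEN and asserted nowhere in this file.  What is recorded here, for ALL supports and with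
no `def` (pure identities and sign lemmas), is the elementary algebra behind the cell's «four nodes» re-representation of a
`(3,4)` pencil (engine-2 `CUBIC-REREP.md` §7/§13; Cayley's 4-nodal cubic symmetroid `e₃ = 0`):

* `det_sum_four_rankOne` — CAUCHY–BINET for a `3 × 3` matrix spanned by four rank-one symmetric matrices:
  `det (∑ᵢ ℓᵢ • vᵢvᵢᵀ) = ∑ᵢ Cᵢ² · ∏_{j ≠ i} ℓⱼ`, `Cᵢ` = the `3 × 3` determinant of the other three vectors (written out; `ring`),
  with `cofactor_eq_det` identifying `C₀` as a determinant and `det_sum_four_rankOne_one` the case `ℓ = 1` (`det ∑ vᵢvᵢᵀ = ∑ Cᵢ²`);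
* `eval_det_pencil_rankOneLetters` — a pencil whose letters are combinations of four FIXED rank-one matrices,
  `S l = ∑ᵢ A i l • vᵢvᵢᵀ`, has `det F(t) = det (∑ᵢ ℓᵢ(t) • vᵢvᵢᵀ)` with the four NODE `K`-NOMIALS `ℓᵢ(t) = ∑ₗ A i l · t^(d l)` on the
  SAME support; with the first item, `det F(t) = ∑ᵢ Cᵢ² ∏_{j ≠ i} ℓⱼ(t)` — off the zeros of the `ℓᵢ` the secular expression
  `e₄(ℓ) · ∑ᵢ Cᵢ²/ℓᵢ` (`sum_div_mul_prod_eq_nodeSum`);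
* `eval_det_pencil_ne_zero_of_sameSign` — the first ROOT-SIDE consequence: if the `vᵢ` span `ℝ³` (`det ∑ vᵢvᵢᵀ ≠ 0`) then
  `det F(t) ≠ 0` wherever the four node `K`-nomials share a strict sign: positive det-roots of such a pencil live where the sign
  vector of `(ℓ₀,…,ℓ₃)(t)` is MIXED (each `ℓᵢ` has at most `K − 1` sign changes by Descartes);
* three `ring` identities of `e₃(y) = ∑_{i<j<k} yᵢyⱼyₖ` that organise the census's extremal `(3,4)` rows in node coordinates
  (seat report `HOME/DOOR-A-P3-REPORT-val-sym-door-p3.md`; numerics, not theorems): the TRITANGENT factorisation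
  `e₃|_{∑ yᵢ = 0} = −(y₀+y₁)(y₀+y₂)(y₁+y₂)` (the plane `∑ yᵢ = 0` cuts Cayley's surface in its three non-edge lines), the LINE CHART
  `e₃(a, b, −a+ε₁, −b+ε₂) = −(ε₂a² + ε₁b²) + (a+b)ε₁ε₂` (first-order form of `det F` for a net hugging the line `{y₂ = −y₀, y₃ = −y₁}` —
  the observed shape of every census `(3,4)` row with `≥ 16` roots), and the EDGE CHART `e₃(ε₁, ε₂, a, b) = ab(ε₁+ε₂) + ε₁ε₂(a+b)`.

Which nets HAVE rank-one-generated letters (generic ones: the annihilator of `span{S₀,…,S₃}` is a pencil of conics with four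
base points `vᵢ`, real or conjugate — classes R4/R2/R0) is NOT proved here; nothing in this file bounds `ζ_sym(3,4)`, decides
`DoorA34`, or bears on `MatrixDescartes` (stmt-ValiantsHypothesis-18050) / `VP ≠ VNP`.

[folklore] Cauchy–Binet; Cayley's four-nodal cubic surface (Cayley 1869; Salmon, *Geometry of Three Dimensions*); elementary.
-/

-- `Summit.ValiantsHypothesis.ValiantsHypothesis.…` repeats a component by the D-0017 layout
-- (single-conjunct summit), which the `dupNamespace` linter flags; the name is mandated.
set_option linter.dupNamespace false

namespace Summit.ValiantsHypothesis.ValiantsHypothesis.Theorems.LacunarySymmetroidMatrixDescartes.Census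

open Polynomial Finset
open scoped BigOperators Polynomial Matrix
open Summit.ValiantsHypothesis.ValiantsHypothesis.Theorems.SymmetroidDescartes (eval_det_pencil)

/-! ## Cauchy–Binet for four rank-one symmetric letters -/

/-- **Cauchy–Binet for four rank-one symmetric letters.**  For `v₀,…,v₃ ∈ ℝ³` and scalars `ℓ₀,…,ℓ₃`,
`det (∑ᵢ ℓᵢ • vᵢ vᵢᵀ) = ∑ᵢ Cᵢ² · ∏_{j ≠ i} ℓⱼ`, where `Cᵢ` is the `3 × 3` determinant of the three vectors other than `vᵢ`
(written out by cofactors) — the determinant of the compression of `diag(ℓ₀,…,ℓ₃)` along `V = (v₀|v₁|v₂|v₃)`.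
A polynomial identity in `16` variables. [folklore] -/
theorem det_sum_four_rankOne (v : Fin 4 → Fin 3 → ℝ) (ℓ : Fin 4 → ℝ) :
    (∑ i, ℓ i • Matrix.vecMulVec (v i) (v i)).det =
      (v 1 0 * (v 2 1 * v 3 2 - v 3 1 * v 2 2) - v 2 0 * (v 1 1 * v 3 2 - v 3 1 * v 1 2)
          + v 3 0 * (v 1 1 * v 2 2 - v 2 1 * v 1 2)) ^ 2 * (ℓ 1 * ℓ 2 * ℓ 3)
      + (v 0 0 * (v 2 1 * v 3 2 - v 3 1 * v 2 2) - v 2 0 * (v 0 1 * v 3 2 - v 3 1 * v 0 2)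
          + v 3 0 * (v 0 1 * v 2 2 - v 2 1 * v 0 2)) ^ 2 * (ℓ 0 * ℓ 2 * ℓ 3)
      + (v 0 0 * (v 1 1 * v 3 2 - v 3 1 * v 1 2) - v 1 0 * (v 0 1 * v 3 2 - v 3 1 * v 0 2)
          + v 3 0 * (v 0 1 * v 1 2 - v 1 1 * v 0 2)) ^ 2 * (ℓ 0 * ℓ 1 * ℓ 3)
      + (v 0 0 * (v 1 1 * v 2 2 - v 2 1 * v 1 2) - v 1 0 * (v 0 1 * v 2 2 - v 2 1 * v 0 2)
          + v 2 0 * (v 0 1 * v 1 2 - v 1 1 * v 0 2)) ^ 2 * (ℓ 0 * ℓ 1 * ℓ 2) := by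
  rw [Matrix.det_fin_three]
  simp only [Matrix.sum_apply, Fin.sum_univ_four, Matrix.smul_apply, Matrix.vecMulVec_apply, smul_eq_mul]
  ring

/-- The first cofactor expression of `det_sum_four_rankOne` IS the determinant of the matrix with columns `v₁, v₂, v₃`
(the other three are the same statement after relabelling). [folklore] -/
theorem cofactor_eq_det (v : Fin 4 → Fin 3 → ℝ) :
    v 1 0 * (v 2 1 * v 3 2 - v 3 1 * v 2 2) - v 2 0 * (v 1 1 * v 3 2 - v 3 1 * v 1 2)
        + v 3 0 * (v 1 1 * v 2 2 - v 2 1 * v 1 2) = (Matrix.of fun a b : Fin 3 => v b.succ a).det := by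
  rw [Matrix.det_fin_three]
  simp only [Matrix.of_apply, Fin.succ_zero_eq_one, Fin.succ_one_eq_two, show (2 : Fin 3).succ = 3 from rfl]
  ring

/-- The case `ℓ = 1`: `det (∑ᵢ vᵢvᵢᵀ) = ∑ᵢ Cᵢ²` (`= det (V Vᵀ)`); it is non-zero iff the `vᵢ` span `ℝ³`. [folklore] -/
theorem det_sum_four_rankOne_one (v : Fin 4 → Fin 3 → ℝ) :
    (∑ i, Matrix.vecMulVec (v i) (v i)).det =
      (v 1 0 * (v 2 1 * v 3 2 - v 3 1 * v 2 2) - v 2 0 * (v 1 1 * v 3 2 - v 3 1 * v 1 2)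
          + v 3 0 * (v 1 1 * v 2 2 - v 2 1 * v 1 2)) ^ 2
      + (v 0 0 * (v 2 1 * v 3 2 - v 3 1 * v 2 2) - v 2 0 * (v 0 1 * v 3 2 - v 3 1 * v 0 2)
          + v 3 0 * (v 0 1 * v 2 2 - v 2 1 * v 0 2)) ^ 2
      + (v 0 0 * (v 1 1 * v 3 2 - v 3 1 * v 1 2) - v 1 0 * (v 0 1 * v 3 2 - v 3 1 * v 0 2)
          + v 3 0 * (v 0 1 * v 1 2 - v 1 1 * v 0 2)) ^ 2
      + (v 0 0 * (v 1 1 * v 2 2 - v 2 1 * v 1 2) - v 1 0 * (v 0 1 * v 2 2 - v 2 1 * v 0 2)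
          + v 2 0 * (v 0 1 * v 1 2 - v 1 1 * v 0 2)) ^ 2 := by
  have h := det_sum_four_rankOne v (fun _ => 1)
  simp only [one_smul, mul_one] at h
  exact h

/-! ## Sign lemmas for the node sum `∑ᵢ cᵢ ∏_{j ≠ i} ℓⱼ` -/

/-- A node sum with non-negative weights of positive total is POSITIVE at an all-positive value vector. [folklore] -/
theorem nodeSum_pos (c₀ c₁ c₂ c₃ ℓ₀ ℓ₁ ℓ₂ ℓ₃ : ℝ) (h₀ : 0 ≤ c₀) (h₁ : 0 ≤ c₁) (h₂ : 0 ≤ c₂) (h₃ : 0 ≤ c₃)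
    (hc : 0 < c₀ + c₁ + c₂ + c₃) (p₀ : 0 < ℓ₀) (p₁ : 0 < ℓ₁) (p₂ : 0 < ℓ₂) (p₃ : 0 < ℓ₃) :
    0 < c₀ * (ℓ₁ * ℓ₂ * ℓ₃) + c₁ * (ℓ₀ * ℓ₂ * ℓ₃) + c₂ * (ℓ₀ * ℓ₁ * ℓ₃) + c₃ * (ℓ₀ * ℓ₁ * ℓ₂) := by
  have q₀ : 0 < ℓ₁ * ℓ₂ * ℓ₃ := by positivity
  have q₁ : 0 < ℓ₀ * ℓ₂ * ℓ₃ := by positivity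
  have q₂ : 0 < ℓ₀ * ℓ₁ * ℓ₃ := by positivity
  have q₃ : 0 < ℓ₀ * ℓ₁ * ℓ₂ := by positivity
  have t₀ := mul_nonneg h₀ q₀.le; have t₁ := mul_nonneg h₁ q₁.le
  have t₂ := mul_nonneg h₂ q₂.le; have t₃ := mul_nonneg h₃ q₃.le
  rcases h₀.eq_or_lt with e₀ | s₀
  · rcases h₁.eq_or_lt with e₁ | s₁
    · rcases h₂.eq_or_lt with e₂ | s₂
      · have s₃ : 0 < c₃ := by linarith
        nlinarith [mul_pos s₃ q₃]
      · nlinarith [mul_pos s₂ q₂]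
    · nlinarith [mul_pos s₁ q₁]
  · nlinarith [mul_pos s₀ q₀]

/-- … and NEGATIVE at an all-negative value vector (odd degree `3`). [folklore] -/
theorem nodeSum_neg (c₀ c₁ c₂ c₃ ℓ₀ ℓ₁ ℓ₂ ℓ₃ : ℝ) (h₀ : 0 ≤ c₀) (h₁ : 0 ≤ c₁) (h₂ : 0 ≤ c₂) (h₃ : 0 ≤ c₃)
    (hc : 0 < c₀ + c₁ + c₂ + c₃) (n₀ : ℓ₀ < 0) (n₁ : ℓ₁ < 0) (n₂ : ℓ₂ < 0) (n₃ : ℓ₃ < 0) :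
    c₀ * (ℓ₁ * ℓ₂ * ℓ₃) + c₁ * (ℓ₀ * ℓ₂ * ℓ₃) + c₂ * (ℓ₀ * ℓ₁ * ℓ₃) + c₃ * (ℓ₀ * ℓ₁ * ℓ₂) < 0 := by
  have h := nodeSum_pos c₀ c₁ c₂ c₃ (-ℓ₀) (-ℓ₁) (-ℓ₂) (-ℓ₃) h₀ h₁ h₂ h₃ hc
    (neg_pos.mpr n₀) (neg_pos.mpr n₁) (neg_pos.mpr n₂) (neg_pos.mpr n₃)
  linarith

/-- Off the zeros of the values the node sum is the SECULAR expression `e₄(ℓ) · ∑ᵢ cᵢ/ℓᵢ`. [folklore] -/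
theorem sum_div_mul_prod_eq_nodeSum (c₀ c₁ c₂ c₃ ℓ₀ ℓ₁ ℓ₂ ℓ₃ : ℝ) (h₀ : ℓ₀ ≠ 0) (h₁ : ℓ₁ ≠ 0) (h₂ : ℓ₂ ≠ 0)
    (h₃ : ℓ₃ ≠ 0) :
    (c₀ / ℓ₀ + c₁ / ℓ₁ + c₂ / ℓ₂ + c₃ / ℓ₃) * (ℓ₀ * ℓ₁ * ℓ₂ * ℓ₃) =
      c₀ * (ℓ₁ * ℓ₂ * ℓ₃) + c₁ * (ℓ₀ * ℓ₂ * ℓ₃) + c₂ * (ℓ₀ * ℓ₁ * ℓ₃) + c₃ * (ℓ₀ * ℓ₁ * ℓ₂) := by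
  have e₀ : c₀ / ℓ₀ * (ℓ₀ * ℓ₁ * ℓ₂ * ℓ₃) = c₀ * (ℓ₁ * ℓ₂ * ℓ₃) := by field_simp
  have e₁ : c₁ / ℓ₁ * (ℓ₀ * ℓ₁ * ℓ₂ * ℓ₃) = c₁ * (ℓ₀ * ℓ₂ * ℓ₃) := by field_simp
  have e₂ : c₂ / ℓ₂ * (ℓ₀ * ℓ₁ * ℓ₂ * ℓ₃) = c₂ * (ℓ₀ * ℓ₁ * ℓ₃) := by field_simp
  have e₃ : c₃ / ℓ₃ * (ℓ₀ * ℓ₁ * ℓ₂ * ℓ₃) = c₃ * (ℓ₀ * ℓ₁ * ℓ₂) := by field_simp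
  rw [add_mul, add_mul, add_mul, e₀, e₁, e₂, e₃]

/-- **No zero in a same-sign chamber.**  If the `vᵢ` span `ℝ³` (`det ∑ᵢ vᵢvᵢᵀ ≠ 0`) and the scalars `ℓᵢ` are all positive
or all negative, then `det (∑ᵢ ℓᵢ • vᵢvᵢᵀ) ≠ 0`. [folklore] -/
theorem det_sum_four_rankOne_ne_zero_of_sameSign (v : Fin 4 → Fin 3 → ℝ) (ℓ : Fin 4 → ℝ)
    (hv : (∑ i, Matrix.vecMulVec (v i) (v i)).det ≠ 0) (hℓ : (∀ i, 0 < ℓ i) ∨ (∀ i, ℓ i < 0)) :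
    (∑ i, ℓ i • Matrix.vecMulVec (v i) (v i)).det ≠ 0 := by
  rw [det_sum_four_rankOne]
  rw [det_sum_four_rankOne_one] at hv
  set C₀ := v 1 0 * (v 2 1 * v 3 2 - v 3 1 * v 2 2) - v 2 0 * (v 1 1 * v 3 2 - v 3 1 * v 1 2)
      + v 3 0 * (v 1 1 * v 2 2 - v 2 1 * v 1 2)
  set C₁ := v 0 0 * (v 2 1 * v 3 2 - v 3 1 * v 2 2) - v 2 0 * (v 0 1 * v 3 2 - v 3 1 * v 0 2)
      + v 3 0 * (v 0 1 * v 2 2 - v 2 1 * v 0 2)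
  set C₂ := v 0 0 * (v 1 1 * v 3 2 - v 3 1 * v 1 2) - v 1 0 * (v 0 1 * v 3 2 - v 3 1 * v 0 2)
      + v 3 0 * (v 0 1 * v 1 2 - v 1 1 * v 0 2)
  set C₃ := v 0 0 * (v 1 1 * v 2 2 - v 2 1 * v 1 2) - v 1 0 * (v 0 1 * v 2 2 - v 2 1 * v 0 2)
      + v 2 0 * (v 0 1 * v 1 2 - v 1 1 * v 0 2)
  have g₀ := sq_nonneg C₀; have g₁ := sq_nonneg C₁; have g₂ := sq_nonneg C₂; have g₃ := sq_nonneg C₃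
  have hc : 0 < C₀ ^ 2 + C₁ ^ 2 + C₂ ^ 2 + C₃ ^ 2 :=
    lt_of_le_of_ne (by positivity) (fun h => hv h.symm)
  rcases hℓ with hp | hn
  · exact ne_of_gt (nodeSum_pos _ _ _ _ _ _ _ _ g₀ g₁ g₂ g₃ hc (hp 0) (hp 1) (hp 2) (hp 3))
  · exact ne_of_lt (nodeSum_neg _ _ _ _ _ _ _ _ g₀ g₁ g₂ g₃ hc (hn 0) (hn 1) (hn 2) (hn 3))

/-! ## Pencils whose letters are combinations of four fixed rank-one matrices -/

/-- Regrouping by nodes: `∑ₗ t^(d l) • (∑ᵢ A i l • vᵢvᵢᵀ) = ∑ᵢ ℓᵢ(t) • vᵢvᵢᵀ` with the NODE `K`-NOMIALS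
`ℓᵢ(t) = ∑ₗ A i l · t^(d l)` — four `K`-nomials on the SAME support. [folklore] -/
theorem pencil_eval_eq_sum_nodeNomial_smul {K : ℕ} (d : Fin K → ℕ) (A : Fin 4 → Fin K → ℝ)
    (v : Fin 4 → Fin 3 → ℝ) (t : ℝ) :
    (∑ l, t ^ d l • ∑ i, A i l • Matrix.vecMulVec (v i) (v i)) =
      ∑ i, (∑ l, A i l * t ^ d l) • Matrix.vecMulVec (v i) (v i) := by
  simp only [Finset.smul_sum, smul_smul, Finset.sum_smul]
  rw [Finset.sum_comm]
  refine Finset.sum_congr rfl fun i _ => Finset.sum_congr rfl fun l _ => ?_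
  rw [mul_comm]

/-- **Node form of the determinant.**  If every letter of a `3 × 3` pencil on the support `d` is a combination of four FIXED
rank-one symmetric matrices, `S l = ∑ᵢ A i l • vᵢvᵢᵀ`, then `det F(t) = det (∑ᵢ ℓᵢ(t) • vᵢvᵢᵀ)` with `ℓᵢ(t) = ∑ₗ A i l t^(d l)`;
by `det_sum_four_rankOne` this is `∑ᵢ Cᵢ² ∏_{j ≠ i} ℓⱼ(t)` (for `K = 4`, `A` invertible: Cayley's 4-nodal cubic symmetroid
pulled back along the monomial curve). [folklore] -/
theorem eval_det_pencil_rankOneLetters {K : ℕ} (d : Fin K → ℕ) (A : Fin 4 → Fin K → ℝ) (v : Fin 4 → Fin 3 → ℝ)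
    (t : ℝ) :
    ((∑ l, (X : ℝ[X]) ^ d l • (∑ i, A i l • Matrix.vecMulVec (v i) (v i)).map C).det).eval t =
      (∑ i, (∑ l, A i l * t ^ d l) • Matrix.vecMulVec (v i) (v i)).det := by
  rw [eval_det_pencil, pencil_eval_eq_sum_nodeNomial_smul]

/-- **No det-root in a same-sign chamber of the nodes.**  For a pencil with rank-one-generated letters
`S l = ∑ᵢ A i l • vᵢvᵢᵀ`, `vᵢ` spanning `ℝ³`, `det F(t) ≠ 0` at every `t` where the four node `K`-nomials `ℓᵢ(t)` are all
positive or all negative: the det-roots lie where the sign vector of `(ℓ₀,…,ℓ₃)(t)` is mixed. [folklore] -/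
theorem eval_det_pencil_ne_zero_of_sameSign {K : ℕ} (d : Fin K → ℕ) (A : Fin 4 → Fin K → ℝ)
    (v : Fin 4 → Fin 3 → ℝ) (hv : (∑ i, Matrix.vecMulVec (v i) (v i)).det ≠ 0) (t : ℝ)
    (ht : (∀ i, 0 < ∑ l, A i l * t ^ d l) ∨ (∀ i, ∑ l, A i l * t ^ d l < 0)) :
    ((∑ l, (X : ℝ[X]) ^ d l • (∑ i, A i l • Matrix.vecMulVec (v i) (v i)).map C).det).eval t ≠ 0 := by
  rw [eval_det_pencil_rankOneLetters]
  exact det_sum_four_rankOne_ne_zero_of_sameSign v (fun i => ∑ l, A i l * t ^ d l) hv ht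

/-- Hence such a `t > 0` is not among the positive det-roots. [folklore] -/
theorem not_isRoot_det_pencil_of_sameSign {K : ℕ} (d : Fin K → ℕ) (A : Fin 4 → Fin K → ℝ)
    (v : Fin 4 → Fin 3 → ℝ) (hv : (∑ i, Matrix.vecMulVec (v i) (v i)).det ≠ 0) (t : ℝ)
    (ht : (∀ i, 0 < ∑ l, A i l * t ^ d l) ∨ (∀ i, ∑ l, A i l * t ^ d l < 0)) :
    ¬ ((∑ l, (X : ℝ[X]) ^ d l • (∑ i, A i l • Matrix.vecMulVec (v i) (v i)).map C).det).IsRoot t :=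
  eval_det_pencil_ne_zero_of_sameSign d A v hv t ht

/-! ## Three identities of Cayley's cubic `e₃` (node coordinates of the census) -/

/-- **Tritangent factorisation.**  On the plane `y₀ + y₁ + y₂ + y₃ = 0` Cayley's cubic `e₃(y) = ∑_{i<j<k} yᵢyⱼyₖ` factors into
three linear forms, `e₃ = −(y₀+y₁)(y₀+y₂)(y₁+y₂)`: the plane cuts the surface `e₃ = 0` in its three non-edge lines
`{yᵢ + yⱼ = 0 = yₖ + yₗ}`. [folklore] -/
theorem e3_tritangent (y₀ y₁ y₂ y₃ : ℝ) (h : y₀ + y₁ + y₂ + y₃ = 0) :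
    y₀ * y₁ * y₂ + y₀ * y₁ * y₃ + y₀ * y₂ * y₃ + y₁ * y₂ * y₃ = -((y₀ + y₁) * (y₀ + y₂) * (y₁ + y₂)) := by
  have h3 : y₃ = -(y₀ + y₁ + y₂) := by linarith
  rw [h3]; ring

/-- **Line chart.**  In coordinates adapted to the line `{y₂ = −y₀, y₃ = −y₁}` of the surface `e₃ = 0`,
`e₃(a, b, −a + ε₁, −b + ε₂) = −(ε₂ a² + ε₁ b²) + (a + b) ε₁ ε₂`: along the line (`ε = 0`) the cubic vanishes identically and
its first-order part is `−(ε₂ a² + ε₁ b²)`, quadratic in the position `(a : b)` on the line (the tangent planes of the surface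
rotate with degree `2` along it).  For a pencil in node coordinates with node `K`-nomials `(a, b, −a + ε₁, −b + ε₂)(t)` this is
an exact formula for `det F(t)` up to the constant weight. [folklore] -/
theorem e3_lineChart (a b ε₁ ε₂ : ℝ) :
    a * b * (-a + ε₁) + a * b * (-b + ε₂) + a * (-a + ε₁) * (-b + ε₂) + b * (-a + ε₁) * (-b + ε₂) =
      -(ε₂ * a ^ 2 + ε₁ * b ^ 2) + (a + b) * ε₁ * ε₂ := by
  ring

/-- **Edge chart**, for contrast: near the edge line `{y₀ = y₁ = 0}` (through two nodes),
`e₃(ε₁, ε₂, a, b) = a b (ε₁ + ε₂) + ε₁ ε₂ (a + b)` — first-order part `a b (ε₁ + ε₂)`, a product of three values. [folklore] -/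
theorem e3_edgeChart (a b ε₁ ε₂ : ℝ) :
    ε₁ * ε₂ * a + ε₁ * ε₂ * b + ε₁ * a * b + ε₂ * a * b = a * b * (ε₁ + ε₂) + ε₁ * ε₂ * (a + b) := by
  ring

/-! ## Appended (same seat): the definite node chambers — all node values non-negative forces `F(t)` positive semidefinite -/

/-- A rank-one matrix `v vᵀ` is positive semidefinite (`xᵀ(v vᵀ)x = (v·x)²`). [folklore] -/
theorem vecMulVec_self_posSemidef (a : Fin 3 → ℝ) : (Matrix.vecMulVec a a).PosSemidef := by
  refine Matrix.PosSemidef.of_dotProduct_mulVec_nonneg ?_ fun x => ?_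
  · ext i j
    simp [Matrix.vecMulVec_apply, mul_comm]
  · have h : star x ⬝ᵥ (Matrix.vecMulVec a a *ᵥ x) = (∑ i, a i * x i) * ∑ j, a j * x j := by
      rw [Finset.sum_mul_sum]
      simp only [dotProduct, Matrix.mulVec, Matrix.vecMulVec_apply, star_trivial, Finset.mul_sum]
      exact Finset.sum_congr rfl fun i _ => Finset.sum_congr rfl fun j _ => by ring
    rw [h]
    exact mul_self_nonneg _

/-- **All node values non-negative ⇒ positive semidefinite.**  `∑ᵢ ℓᵢ • vᵢvᵢᵀ` is positive semidefinite whenever every `ℓᵢ ≥ 0`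
(the all-positive node chamber is a DEFINITE chamber: together with `det_sum_four_rankOne_ne_zero_of_sameSign`, positive definite when
the `vᵢ` span). [folklore] -/
theorem posSemidef_sum_smul_vecMulVec_of_nonneg (v : Fin 4 → Fin 3 → ℝ) (ℓ : Fin 4 → ℝ) (hℓ : ∀ i, 0 ≤ ℓ i) :
    (∑ i, ℓ i • Matrix.vecMulVec (v i) (v i)).PosSemidef :=
  Matrix.posSemidef_sum Finset.univ fun i _ => Matrix.PosSemidef.smul (vecMulVec_self_posSemidef (v i)) (hℓ i)

/-- … and `−(∑ᵢ ℓᵢ • vᵢvᵢᵀ)` is positive semidefinite whenever every `ℓᵢ ≤ 0` (the all-negative node chamber). [folklore] -/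
theorem posSemidef_neg_sum_smul_vecMulVec_of_nonpos (v : Fin 4 → Fin 3 → ℝ) (ℓ : Fin 4 → ℝ) (hℓ : ∀ i, ℓ i ≤ 0) :
    (-(∑ i, ℓ i • Matrix.vecMulVec (v i) (v i))).PosSemidef := by
  have h : -(∑ i, ℓ i • Matrix.vecMulVec (v i) (v i)) = ∑ i, (-ℓ i) • Matrix.vecMulVec (v i) (v i) := by
    rw [← Finset.sum_neg_distrib]
    exact Finset.sum_congr rfl fun i _ => (neg_smul _ _).symm
  rw [h]
  exact posSemidef_sum_smul_vecMulVec_of_nonneg v (fun i => -ℓ i) fun i => neg_nonneg.mpr (hℓ i)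

/-- **Pencil version.**  For a pencil with rank-one-generated letters `S l = ∑ᵢ A i l • vᵢvᵢᵀ`, at every `t` where the four node
`K`-nomials `ℓᵢ(t) = ∑ₗ A i l t^(d l)` are all `≥ 0` the matrix `F(t) = ∑ₗ t^(d l) • S l` is positive semidefinite (and negative
semidefinite where they are all `≤ 0`): inertia changes — hence all det-roots between definite chambers of opposite sign — are confined to
the mixed-sign chambers of the nodes. [folklore] -/
theorem pencil_eval_posSemidef_of_nodeNomial_nonneg {K : ℕ} (d : Fin K → ℕ) (A : Fin 4 → Fin K → ℝ) (v : Fin 4 → Fin 3 → ℝ)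
    (t : ℝ) (ht : ∀ i, 0 ≤ ∑ l, A i l * t ^ d l) :
    (∑ l, t ^ d l • ∑ i, A i l • Matrix.vecMulVec (v i) (v i)).PosSemidef := by
  rw [pencil_eval_eq_sum_nodeNomial_smul]
  exact posSemidef_sum_smul_vecMulVec_of_nonneg v _ ht

/-- The all-non-positive node chamber: `−F(t)` is positive semidefinite. [folklore] -/
theorem pencil_eval_neg_posSemidef_of_nodeNomial_nonpos {K : ℕ} (d : Fin K → ℕ) (A : Fin 4 → Fin K → ℝ) (v : Fin 4 → Fin 3 → ℝ)
    (t : ℝ) (ht : ∀ i, ∑ l, A i l * t ^ d l ≤ 0) :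
    (-(∑ l, t ^ d l • ∑ i, A i l • Matrix.vecMulVec (v i) (v i))).PosSemidef := by
  rw [pencil_eval_eq_sum_nodeNomial_smul]
  exact posSemidef_neg_sum_smul_vecMulVec_of_nonpos v _ ht

end Summit.ValiantsHypothesis.ValiantsHypothesis.Theorems.LacunarySymmetroidMatrixDescartes.Census
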